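import Literature.Analysis.Fourier.LogPhaseIntegral
import Literature.Analysis.Fourier.StationaryPhaseSharp
import HarnessLib

/-!
# The oscillatory integral `∫ g(t) e^{i t log(t/(ec))} dt` with error `O(1)` (Levinson 1974, Lemmas 3.3–3.4)

Topic `Literature/Analysis/Fourier`. Everything in this file is PROVED (no definitions, no named
facts).

The cross terms of every mean-value computation based on the approximate functional equation of
`ζ` are the oscillatory integrals
`∫_A^B g(t) exp[i t log(t/(er))] dt`, `g(t) = (t/2π)^{½−a}` (the modulus of `χ(a − it)`,
Titchmarsh (4.12.3); `Literature/NumberTheory/LFunctions/RiemannSiegelChiStirling.lean`), with the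
stationary point `t = r`. N. Levinson, *More than one third of zeros of Riemann's zeta-function are on
`σ = 1/2`*, Adv. Math. 13 (1974), §3:

* **Lemma 3.3**: "`∫_{r(1−c)}^{r(1+c)} exp[it log(t/re)] dt = (2πr)^{1/2} e^{−ir+πi/4} + O(1)`";
* **Lemma 3.4**: "For large `A` and `A ≤ r ≤ B ≤ A + A/log A`,
  `∫_A^B exp[it log(t/re)] (t/2π)^{1/2−a} dt = (2π)^a r^{1−a} e^{−ir+πi/4} + E(r)`,
  `E(r) = O(1) + O(A/(|A−r| + A^{1/2})) + O(B/(|B−r| + B^{1/2}))`; for `r < A` or `r > B` the integral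
  is `E(r)`."

The point is the interior error `O(1)`: in Levinson's `I₁₂` these integrals are summed over
`≍ T (log T)^{−20}` frequencies `r = 2πknm/k'` with bounded weights, so that Titchmarsh's Lemma 4.6
(error `O(T^{2/5})`, used in the tree's `LogPhaseIntegral.lean` for §9.22) would lose a power of `T`.
We obtain it from the tree's proof of Graham–Kolesnik's Lemma 3.4
(`Literature.Analysis.Fourier.GK34.GrahamKolesnik_lemma34`, `StationaryPhaseSharp.lean`): for the phase
`F(t) = t log(t/(ec))` on `[T, T₂] ⊆ [T, 2T]` one has `F″ = 1/t ≥ 1/(2T)`, `|F⁽³⁾| ≤ 1/T²`,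
`|F⁽⁴⁾| ≤ 2/T³`, so the interior error `17(T₂−T)(λ₄λ₂⁻² + λ₃²λ₂⁻³)` is `≤ 272`, and the end-point
errors `1/max(λ₂ d, λ₂^{1/2})` are at most Levinson's `4T/(d + √(2T))`.

## Main results (absolute constants, not optimised)

* `norm_logPhaseIntegral_sub_main_le_sharp` — for `0 < T ≤ c ≤ T₂ ≤ 2T`:
  `‖∫_T^{T₂} e^{i t log(t/(ec))} dt − 𝔣 e^{−ic} c^{1/2}‖ ≤ 272 + 30 (4T/((c−T) + √(2T)) + 4T/((T₂−c) + √(2T)))`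
  (`𝔣 = Literature.Analysis.Fourier.fresnelC = (2π)^{1/2} e^{iπ/4}`, so the main term is
  `(2πc)^{1/2} e^{πi/4 − ic}`: Lemma 3.3);
* `norm_logPhaseIntegral_sub_indicator_main_le_sharp` — all `c > 0` at once, the main term present
  iff `T ≤ c ≤ T₂`: error `275 + 32 (4T/(|c−T| + √(2T)) + 4T/(|T₂−c| + √(2T)))` (the non-stationary
  cases by the first-derivative bounds of `LogPhaseIntegral.lean`);
* `norm_integral_mul_logPhase_sub_le` — a `C¹` amplitude `g` (`‖g‖ ≤ G₀`, `‖g'‖ ≤ G₁` on `[T, T₂]`):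
  main term `g(c) 𝔣 e^{−ic} c^{1/2}`, error
  `(G₀ + (T₂−T)G₁)(275 + 32·4T/(|c−T|+√(2T))) + 32 G₀·4T/(|T₂−c|+√(2T)) + 256 G₁ T log(1+T)`
  (partial integration against the primitive `t ↦ ∫_T^t e^{iF}`, to which the previous result applies
  for every `t`; `integral_levinson_endpoint_le`: `∫_T^{T₂} 4T/(|t−c|+β) dt ≤ 8T log(1 + (T₂−T)/β)`);
* `norm_integral_rpow_mul_logPhase_sub_le` — **Lemma 3.4**: the amplitude `(t/2π)^κ`, `κ ≥ 0`
  (`κ = ½ − a`), error `(T/π)^κ ((1+κ)(275 + 32·4T/(|c−T|+√(2T))) + 32·4T/(|T₂−c|+√(2T)) + 256 κ log(1+T))`,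
  which for `κ = O(1/log T)` is Levinson's `E(c)`.

## References

* N. Levinson, *More than one third of zeros of Riemann's zeta-function are on `σ = 1/2`*,
  Adv. Math. 13 (1974), 383–436, §3, Lemmas 3.3–3.4 and eq. (3.8). [Levinson1974]
* S. W. Graham, G. Kolesnik, *Van der Corput's Method of Exponential Sums*, LMS LNS 126 (1991),
  Lemma 3.4. [GrahamKolesnik1991]
* E. C. Titchmarsh, *The Theory of the Riemann Zeta-Function*, 2nd ed. (1986), §4.6 (Lemma 4.6),
  §7.4, §9.22. [Titchmarsh1986]
-/

noncomputable section

open MeasureTheory Set intervalIntegral Complex Filter Topology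
open scoped Real

namespace Literature.Analysis.Fourier

/-! ### Derivatives and continuity of the phase -/

/-- `(-1/t²)' = 2/t³`. [folklore] -/
theorem hasDerivAt_logPhase''' {t : ℝ} (ht : 0 < t) :
    HasDerivAt (fun t : ℝ => -1 / t ^ 2) (2 / t ^ 3) t := by
  have h : HasDerivAt (fun t : ℝ => t ^ 2) (2 * t) t := by
    simpa using hasDerivAt_pow 2 t
  have h2 := (h.inv (by positivity)).neg
  have hfun : (fun t : ℝ => -1 / t ^ 2) = fun t => -(t ^ 2)⁻¹ := by ext; rw [neg_div, one_div]
  rw [hfun]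
  refine h2.congr_deriv ?_
  field_simp

/-- The integrand `e^{i t log(t/(ec))}` is continuous on `ℝ` (`t log(t/(ec)) = t log t − t log(ec)`,
and `t log t` is continuous). [folklore] -/
theorem continuous_logPhaseExp {c : ℝ} (hc : 0 < c) :
    Continuous fun t : ℝ => cexp (I * ((t * Real.log (t / (Real.exp 1 * c)) : ℝ) : ℂ)) := by
  have hec : Real.exp 1 * c ≠ 0 := (mul_pos (Real.exp_pos 1) hc).ne'
  have hfun : (fun t : ℝ => t * Real.log (t / (Real.exp 1 * c))) =
      fun t => t * Real.log t - t * Real.log (Real.exp 1 * c) := by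
    funext t
    rcases eq_or_ne t 0 with h | h
    · simp [h]
    · rw [Real.log_div h hec]; ring
  have hcont : Continuous fun t : ℝ => t * Real.log (t / (Real.exp 1 * c)) := by
    rw [hfun]
    exact Real.continuous_mul_log.sub (continuous_id.mul continuous_const)
  exact Complex.continuous_exp.comp (continuous_const.mul (Complex.continuous_ofReal.comp hcont))

/-! ### Levinson's end-point functional `4T/(|d| + √(2T))` -/

/-- `1/max(x, y) ≤ 2/(x + y)` for `x ≥ 0`, `y > 0`. [folklore] -/
theorem one_div_max_le_two_div_add {x y : ℝ} (hx : 0 ≤ x) (hy : 0 < y) :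
    1 / max x y ≤ 2 / (x + y) := by
  rw [div_le_div_iff₀ (lt_of_lt_of_le hy (le_max_right _ _)) (by linarith)]
  have h1 := le_max_left x y
  have h2 := le_max_right x y
  linarith

/-- The Graham–Kolesnik end-point term with `λ₂ = 1/(2T)` is at most Levinson's
`4T/(d + √(2T))`: `1/max(d/(2T), (2T)^{-1/2}) ≤ 4T/(d + √(2T))` for `d ≥ 0`. [folklore] -/
theorem one_div_max_le_levinson {T d : ℝ} (hT : 0 < T) (hd : 0 ≤ d) :
    1 / max (1 / (2 * T) * d) (Real.sqrt (1 / (2 * T))) ≤ 4 * T / (d + Real.sqrt (2 * T)) := by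
  have h2T : 0 < 2 * T := by linarith
  have hs : 0 < Real.sqrt (2 * T) := Real.sqrt_pos.2 h2T
  have hsq : Real.sqrt (1 / (2 * T)) = 1 / Real.sqrt (2 * T) := by
    rw [Real.sqrt_div' 1 h2T.le, Real.sqrt_one]
  rw [hsq]
  refine (one_div_max_le_two_div_add (by positivity) (by positivity)).trans (le_of_eq ?_)
  have hss : Real.sqrt (2 * T) * Real.sqrt (2 * T) = 2 * T := Real.mul_self_sqrt h2T.le
  field_simp
  nlinarith [hss]

/-- The first-derivative bounds of the non-stationary cases are dominated by Levinson's
functional: for `0 < d`, `0 < ℓ`, `d/K ≤ ℓ` with `0 < K ≤ 4T`, and `T₂ ≤ 2T`,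
`min(2/ℓ, 8√T₂) ≤ 32T/(d + √(2T))`. [folklore] -/
theorem min_le_levinson {T T₂ d ℓ K : ℝ} (hT : 0 < T) (hT₂ : T₂ ≤ 2 * T) (hd : 0 < d)
    (hℓ : 0 < ℓ) (hK : K ≤ 4 * T) (hℓd : d / K ≤ ℓ) (hK0 : 0 < K) :
    min (2 / ℓ) (8 * Real.sqrt T₂) ≤ 32 * T / (d + Real.sqrt (2 * T)) := by
  have h2T : 0 < 2 * T := by linarith
  have hs : 0 < Real.sqrt (2 * T) := Real.sqrt_pos.2 h2T
  have hss : Real.sqrt (2 * T) * Real.sqrt (2 * T) = 2 * T := Real.mul_self_sqrt h2T.le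
  have hsT₂ : Real.sqrt T₂ ≤ Real.sqrt (2 * T) := Real.sqrt_le_sqrt hT₂
  rcases le_or_gt (Real.sqrt (2 * T)) d with hcase | hcase
  · -- `d ≥ √(2T)`: use `2/ℓ ≤ 2K/d ≤ 8T/d ≤ 16T/(d + √(2T))`
    have h1 : 2 / ℓ ≤ 2 * K / d := by
      rw [div_le_div_iff₀ hℓ hd]
      rw [div_le_iff₀ hK0] at hℓd
      nlinarith
    calc min (2 / ℓ) (8 * Real.sqrt T₂) ≤ 2 / ℓ := min_le_left _ _
      _ ≤ 2 * K / d := h1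
      _ ≤ 8 * T / d := div_le_div_of_nonneg_right (by linarith) hd.le
      _ ≤ 32 * T / (d + Real.sqrt (2 * T)) := by
          rw [div_le_div_iff₀ hd (by positivity)]
          nlinarith
  · -- `d < √(2T)`: use `8√T₂ ≤ 8√(2T) = 16T/√(2T) ≤ 32T/(d + √(2T))`
    calc min (2 / ℓ) (8 * Real.sqrt T₂) ≤ 8 * Real.sqrt T₂ := min_le_right _ _
      _ ≤ 8 * Real.sqrt (2 * T) := by gcongr
      _ ≤ 32 * T / (d + Real.sqrt (2 * T)) := by
          rw [le_div_iff₀ (by positivity)]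
          nlinarith

/-! ### The stationary case, sharp -/

/-- **Levinson's Lemma 3.3 / Titchmarsh (9.22.2) with error `O(1)`.** For `0 < T ≤ c ≤ T₂ ≤ 2T`:
`‖∫_T^{T₂} e^{i t log(t/(ec))} dt − 𝔣 e^{−ic} c^{1/2}‖ ≤ 272 + 30 (4T/((c−T) + √(2T)) + 4T/((T₂−c) + √(2T)))`,
`𝔣 = fresnelC = (2π)^{1/2} e^{iπ/4}` (Graham–Kolesnik's Lemma 3.4,
`Literature.Analysis.Fourier.GrahamKolesnik_lemma34`, with `λ₂ = 1/(2T)`, `λ₃ = 1/T²`, `λ₄ = 2/T³`: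
the interior error `17(T₂−T)(λ₄/λ₂² + λ₃²/λ₂³) ≤ 272` is bounded, where Titchmarsh's Lemma 4.6 gives
`O(T^{2/5})`). [cite: Levinson1974, Lemma 3.3] -/
theorem norm_logPhaseIntegral_sub_main_le_sharp {T T₂ c : ℝ} (hT : 0 < T) (hTc : T ≤ c)
    (hcT₂ : c ≤ T₂) (hT₂ : T₂ ≤ 2 * T) :
    ‖(∫ t in T..T₂, cexp (I * ((t * Real.log (t / (Real.exp 1 * c)) : ℝ) : ℂ)))
        - fresnelC * cexp (-I * c) * (Real.sqrt c : ℂ)‖ ≤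
      272 + 30 * (4 * T / ((c - T) + Real.sqrt (2 * T)) + 4 * T / ((T₂ - c) + Real.sqrt (2 * T))) := by
  have hc : 0 < c := hT.trans_le hTc
  have hT₂0 : 0 < T₂ := hc.trans_le hcT₂
  have hTT₂ : T ≤ T₂ := hTc.trans hcT₂
  set F : ℝ → ℝ := fun t => t * Real.log (t / (Real.exp 1 * c)) with hF
  set F' : ℝ → ℝ := fun t => Real.log (t / c) with hF'
  set F'' : ℝ → ℝ := fun t => 1 / t with hF''
  set F''' : ℝ → ℝ := fun t => -1 / t ^ 2 with hF'''
  set F'''' : ℝ → ℝ := fun t => 2 / t ^ 3 with hF''''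
  set lam2 : ℝ := 1 / (2 * T) with hlam2
  set lam3 : ℝ := 1 / T ^ 2 with hlam3
  set lam4 : ℝ := 2 / T ^ 3 with hlam4
  have hlam2pos : 0 < lam2 := by positivity
  have hlam3pos : 0 < lam3 := by positivity
  have hpos : ∀ x ∈ Icc T T₂, 0 < x := fun x hx => hT.trans_le hx.1
  have hFd : ∀ x ∈ Icc T T₂, HasDerivAt F (F' x) x := fun x hx => hasDerivAt_logPhase hc (hpos x hx)
  have hF'd : ∀ x ∈ Icc T T₂, HasDerivAt F' (F'' x) x := fun x hx => hasDerivAt_logPhase' hc (hpos x hx)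
  have hF''d : ∀ x ∈ Icc T T₂, HasDerivAt F'' (F''' x) x := fun x hx => hasDerivAt_logPhase'' (hpos x hx)
  have hF'''d : ∀ x ∈ Icc T T₂, HasDerivAt F''' (F'''' x) x := fun x hx =>
    hasDerivAt_logPhase''' (hpos x hx)
  have h2 : ∀ x ∈ Icc T T₂, lam2 ≤ F'' x := by
    intro x hx
    simp only [hF'', hlam2]
    exact one_div_le_one_div_of_le (hpos x hx) (hx.2.trans hT₂)
  have h3 : ∀ x ∈ Icc T T₂, |F''' x| ≤ lam3 := by
    intro x hx
    have hx0 := hpos x hx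
    simp only [hF''', hlam3]
    rw [abs_div, abs_neg, abs_one, abs_of_pos (by positivity)]
    exact one_div_le_one_div_of_le (by positivity) (pow_le_pow_left₀ hT.le hx.1 2)
  have h4 : ∀ x ∈ Icc T T₂, |F'''' x| ≤ lam4 := by
    intro x hx
    have hx0 := hpos x hx
    simp only [hF'''', hlam4]
    rw [abs_div, abs_two, abs_of_pos (by positivity)]
    exact div_le_div_of_nonneg_left (by norm_num) (by positivity) (pow_le_pow_left₀ hT.le hx.1 3)
  have hc0 : F' c = 0 := by simp [hF']
  have key := GK34.GrahamKolesnik_lemma34 (F := F) (F' := F') (F'' := F'') (F''' := F''') (F'''' := F'''')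
    hTc hcT₂ hlam2pos hlam3pos hFd hF'd hF''d hF'''d h2 h3 h4 hc0
  -- identify the main term
  have hFc : F c = -c := by
    simp only [hF]
    rw [mul_comm (Real.exp 1) c, ← div_div, div_self hc.ne', one_div, Real.log_inv, Real.log_exp]
    ring
  have hF''c : F'' c = 1 / c := rfl
  have hmain : fresnelC * cexp (I * F c) * (((Real.sqrt (F'' c))⁻¹ : ℝ) : ℂ) =
      fresnelC * cexp (-I * c) * (Real.sqrt c : ℂ) := by
    rw [hFc, hF''c, Real.sqrt_div' 1 hc.le, Real.sqrt_one, inv_div, div_one]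
    push_cast
    ring_nf
  rw [hmain] at key
  refine key.trans ?_
  -- the error terms
  have hR2 : 17 * ((T₂ - T) * (lam4 / lam2 ^ 2 + lam3 ^ 2 / lam2 ^ 3)) ≤ 272 := by
    have e : lam4 / lam2 ^ 2 + lam3 ^ 2 / lam2 ^ 3 = 16 / T := by
      simp only [hlam2, hlam3, hlam4]
      field_simp
      ring
    rw [e]
    have : (T₂ - T) * (16 / T) ≤ 16 := by
      rw [mul_div_assoc', div_le_iff₀ hT]; nlinarith
    linarith
  have hE1 := one_div_max_le_levinson hT (sub_nonneg.2 hTc)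
  have hE2 := one_div_max_le_levinson hT (sub_nonneg.2 hcT₂)
  simp only [hlam2] at hE1 hE2 ⊢
  linarith

/-! ### All positions of the stationary point -/

/-- **The three cases in one, sharp form** (Levinson's Lemma 3.4 with constant amplitude): for
`0 < T ≤ T₂ ≤ 2T`, `1 ≤ T` and `c > 0`,
`‖∫_T^{T₂} e^{i t log(t/(ec))} dt − [T ≤ c ≤ T₂] 𝔣 e^{−ic} c^{1/2}‖ ≤ 275 + 32 (4T/(|c−T| + √(2T)) + 4T/(|T₂−c| + √(2T)))`
(outside `[T, T₂]` the first-derivative bounds `min(2/|log(T/c)|, 8√T₂)` of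
`LogPhaseIntegral.lean` are at most `8 · 4T/(|c−T| + √(2T))`, resp. `≤ 3` when `c ∉ [T/2, 2T₂]`).
[cite: Levinson1974, Lemma 3.4] -/
theorem norm_logPhaseIntegral_sub_indicator_main_le_sharp {T T₂ c : ℝ} (hT : 0 < T) (hTT₂ : T ≤ T₂)
    (hT₂ : T₂ ≤ 2 * T) (hc : 0 < c) :
    ‖(∫ t in T..T₂, cexp (I * ((t * Real.log (t / (Real.exp 1 * c)) : ℝ) : ℂ)))
        - (if T ≤ c ∧ c ≤ T₂ then fresnelC * cexp (-I * c) * (Real.sqrt c : ℂ) else 0)‖ ≤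
      275 + 32 * (4 * T / (|c - T| + Real.sqrt (2 * T)) + 4 * T / (|T₂ - c| + Real.sqrt (2 * T))) := by
  have hT₂0 : 0 < T₂ := hT.trans_le hTT₂
  have h2T : 0 < 2 * T := by linarith
  have hs : 0 < Real.sqrt (2 * T) := Real.sqrt_pos.2 h2T
  have hE1 : 0 ≤ 4 * T / (|c - T| + Real.sqrt (2 * T)) := by positivity
  have hE2 : 0 ≤ 4 * T / (|T₂ - c| + Real.sqrt (2 * T)) := by positivity
  have hlog2 : 2 / Real.log 2 ≤ 3 := by
    rw [div_le_iff₀ (Real.log_pos one_lt_two)]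
    nlinarith [Real.log_two_gt_d9]
  split_ifs with h
  · rw [abs_of_nonneg (sub_nonneg.2 h.1)] at hE1 ⊢
    rw [abs_of_nonneg (sub_nonneg.2 h.2)] at hE2 ⊢
    have := norm_logPhaseIntegral_sub_main_le_sharp hT h.1 h.2 hT₂
    linarith
  · rw [sub_zero]
    rcases lt_or_ge c T with hcT | hTc
    · -- `c < T`
      have hb := norm_logPhaseIntegral_le_of_lt hc hcT hTT₂
      rcases le_or_gt c (T / 2) with hc2 | hc2
      · -- far away: `log(T/c) ≥ log 2`
        have hl : Real.log 2 ≤ Real.log (T / c) := by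
          apply Real.log_le_log two_pos
          rw [le_div_iff₀ hc]; linarith
        have : min (2 / Real.log (T / c)) (8 * Real.sqrt T₂) ≤ 3 :=
          (min_le_left _ _).trans ((div_le_div_of_nonneg_left (by norm_num) (Real.log_pos one_lt_two) hl).trans hlog2)
        linarith
      · -- `T/2 < c < T`: `log(T/c) ≥ (T − c)/T`
        have hl : (T - c) / T ≤ Real.log (T / c) := by
          have h2 : 1 - c / T ≤ Real.log (T / c) := by
            have := Real.one_sub_inv_le_log_of_pos (show 0 < T / c by positivity)
            rw [inv_div] at this
            exact this
          have e : (T - c) / T = 1 - c / T := by field_simp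
          linarith [e.le, e.ge]
        have hlpos : 0 < Real.log (T / c) := lt_of_lt_of_le (by apply div_pos <;> linarith) hl
        have hm := min_le_levinson (d := T - c) (ℓ := Real.log (T / c)) (K := T) hT hT₂
          (by linarith) hlpos (by linarith) hl hT
        rw [abs_of_neg (by linarith : c - T < 0), neg_sub]
        have hx : 0 < T - c + Real.sqrt (2 * T) := by linarith
        have h0 : 0 ≤ 4 * T / (T - c + Real.sqrt (2 * T)) := div_nonneg (by linarith) hx.le
        have e : 32 * T / (T - c + Real.sqrt (2 * T)) = 8 * (4 * T / (T - c + Real.sqrt (2 * T))) := by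
          ring
        linarith
    · -- `c > T₂`
      have hT₂c : T₂ < c := by
        by_contra h'
        exact h ⟨hTc, le_of_not_gt h'⟩
      have hb := norm_logPhaseIntegral_le_of_gt hT hTT₂ hT₂c
      rcases le_or_gt (2 * T₂) c with hc2 | hc2
      · -- far away
        have hl : Real.log 2 ≤ Real.log (c / T₂) := by
          apply Real.log_le_log two_pos
          rw [le_div_iff₀ hT₂0]; linarith
        have : min (2 / Real.log (c / T₂)) (8 * Real.sqrt T₂) ≤ 3 :=
          (min_le_left _ _).trans ((div_le_div_of_nonneg_left (by norm_num) (Real.log_pos one_lt_two) hl).trans hlog2)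
        linarith
      · -- `T₂ < c < 2T₂ ≤ 4T`: `log(c/T₂) ≥ (c − T₂)/c ≥ (c − T₂)/(4T)`
        have hl : (c - T₂) / (4 * T) ≤ Real.log (c / T₂) := by
          have h2 : 1 - T₂ / c ≤ Real.log (c / T₂) := by
            have := Real.one_sub_inv_le_log_of_pos (show 0 < c / T₂ by positivity)
            rw [inv_div] at this
            exact this
          have e : 1 - T₂ / c = (c - T₂) / c := by field_simp
          rw [e] at h2
          refine le_trans ?_ h2
          exact div_le_div_of_nonneg_left (by linarith) hc (by linarith)
        have hlpos : 0 < Real.log (c / T₂) := lt_of_lt_of_le (by apply div_pos <;> linarith) hl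
        have hm := min_le_levinson (d := c - T₂) (ℓ := Real.log (c / T₂)) (K := 4 * T) hT hT₂
          (by linarith) hlpos le_rfl hl (by linarith)
        rw [abs_of_neg (by linarith : T₂ - c < 0), neg_sub]
        have hx : 0 < c - T₂ + Real.sqrt (2 * T) := by linarith
        have h0 : 0 ≤ 4 * T / (c - T₂ + Real.sqrt (2 * T)) := div_nonneg (by linarith) hx.le
        have e : 32 * T / (c - T₂ + Real.sqrt (2 * T)) = 8 * (4 * T / (c - T₂ + Real.sqrt (2 * T))) := by
          ring
        linarith

/-! ### A `C¹` amplitude (Levinson's Lemma 3.4) -/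

/-- Levinson's end-point functional integrates to `O(T log T)` across the stationary point:
`∫_T^{T₂} 4T/(|t − c| + β) dt ≤ 8T log(1 + (T₂ − T)/β)` for `β > 0`, `0 ≤ T ≤ T₂` and every real
`c`. [folklore] -/
theorem integral_levinson_endpoint_le {T T₂ c β : ℝ} (hT : 0 ≤ T) (hTT₂ : T ≤ T₂) (hβ : 0 < β) :
    ∫ t in T..T₂, 4 * T / (|t - c| + β) ≤ 8 * T * Real.log (1 + (T₂ - T) / β) := by
  -- the splitting point
  obtain ⟨c', hc'1, hc'2, hright, hleft⟩ : ∃ c' : ℝ, T ≤ c' ∧ c' ≤ T₂ ∧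
      (∀ t ∈ Icc c' T₂, t - c' ≤ |t - c|) ∧ (∀ t ∈ Icc T c', c' - t ≤ |t - c|) := by
    refine ⟨max T (min c T₂), le_max_left _ _, max_le hTT₂ (min_le_right _ _), fun t ht => ?_,
      fun t ht => ?_⟩
    · rcases le_total c T₂ with h | h
      · rw [min_eq_left h] at ht ⊢
        have : c ≤ t := le_trans (le_max_right _ _) ht.1
        rw [abs_of_nonneg (by linarith)]
        linarith [le_max_right T c]
      · rw [min_eq_right h] at ht ⊢
        have h1 : t ≤ T₂ := ht.2
        have h2 : max T T₂ = T₂ := max_eq_right hTT₂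
        rw [h2] at ht ⊢
        rw [abs_of_nonpos (by linarith)]
        linarith
    · rcases le_total c T₂ with h | h
      · rw [min_eq_left h] at ht ⊢
        rcases le_total T c with h' | h'
        · rw [max_eq_right h'] at ht ⊢
          rw [abs_of_nonpos (by linarith [ht.2])]
          linarith
        · rw [max_eq_left h'] at ht ⊢
          have : t = T := le_antisymm ht.2 ht.1
          rw [this]
          linarith [abs_nonneg (T - c)]
      · rw [min_eq_right h, max_eq_right hTT₂] at ht ⊢
        rw [abs_of_nonpos (by linarith [ht.2])]
        linarith [ht.2]
  have hcont : Continuous fun t : ℝ => 4 * T / (|t - c| + β) :=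
    continuous_const.div (by fun_prop) fun t => by positivity
  -- right piece
  have hR : ∫ t in c'..T₂, 4 * T / (|t - c| + β) ≤ 4 * T * Real.log (1 + (T₂ - T) / β) := by
    have hcont2 : ContinuousOn (fun t : ℝ => 4 * T / (t - c' + β)) (Icc c' T₂) := by
      refine continuousOn_const.div (by fun_prop) fun t ht => ?_
      have : 0 ≤ t - c' := sub_nonneg.2 ht.1
      positivity
    have hmono : ∫ t in c'..T₂, 4 * T / (|t - c| + β) ≤ ∫ t in c'..T₂, 4 * T / (t - c' + β) := by
      refine intervalIntegral.integral_mono_on hc'2 (hcont.intervalIntegrable _ _)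
        (hcont2.intervalIntegrable_of_Icc hc'2) fun t ht => ?_
      have h0 : 0 < t - c' + β := by linarith [ht.1]
      exact div_le_div_of_nonneg_left (by positivity) h0 (by linarith [hright t ht])
    have heval : ∫ t in c'..T₂, 4 * T / (t - c' + β) = 4 * T * Real.log ((T₂ - c' + β) / β) := by
      have e1 : (fun t : ℝ => 4 * T / (t - c' + β)) = fun t => 4 * T * (t + (β - c'))⁻¹ := by
        funext t; rw [div_eq_mul_inv]; congr 1; ring
      rw [e1, intervalIntegral.integral_const_mul, intervalIntegral.integral_comp_add_right (fun t => t⁻¹),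
        integral_inv_of_pos (by linarith) (by linarith), show c' + (β - c') = β by ring,
        show T₂ + (β - c') = T₂ - c' + β by ring]
    have hlog : Real.log ((T₂ - c' + β) / β) ≤ Real.log (1 + (T₂ - T) / β) := by
      apply Real.log_le_log (by positivity)
      rw [div_le_iff₀ hβ, add_mul, one_mul, div_mul_cancel₀ _ hβ.ne']
      linarith
    calc _ ≤ _ := hmono
      _ = _ := heval
      _ ≤ 4 * T * Real.log (1 + (T₂ - T) / β) := by gcongr
  -- left piece
  have hL : ∫ t in T..c', 4 * T / (|t - c| + β) ≤ 4 * T * Real.log (1 + (T₂ - T) / β) := by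
    have hcont2 : ContinuousOn (fun t : ℝ => 4 * T / (c' - t + β)) (Icc T c') := by
      refine continuousOn_const.div (by fun_prop) fun t ht => ?_
      have : 0 ≤ c' - t := sub_nonneg.2 ht.2
      positivity
    have hmono : ∫ t in T..c', 4 * T / (|t - c| + β) ≤ ∫ t in T..c', 4 * T / (c' - t + β) := by
      refine intervalIntegral.integral_mono_on hc'1 (hcont.intervalIntegrable _ _)
        (hcont2.intervalIntegrable_of_Icc hc'1) fun t ht => ?_
      have h0 : 0 < c' - t + β := by linarith [ht.2]
      exact div_le_div_of_nonneg_left (by positivity) h0 (by linarith [hleft t ht])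
    have heval : ∫ t in T..c', 4 * T / (c' - t + β) = 4 * T * Real.log ((c' - T + β) / β) := by
      have e1 : (fun t : ℝ => 4 * T / (c' - t + β)) = fun t => 4 * T * ((c' + β) - t)⁻¹ := by
        funext t; rw [div_eq_mul_inv]; congr 1; ring
      rw [e1, intervalIntegral.integral_const_mul, intervalIntegral.integral_comp_sub_left (fun t => t⁻¹),
        integral_inv_of_pos (by linarith) (by linarith), show c' + β - c' = β by ring,
        show c' + β - T = c' - T + β by ring]
    have hlog : Real.log ((c' - T + β) / β) ≤ Real.log (1 + (T₂ - T) / β) := by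
      apply Real.log_le_log (by positivity)
      rw [div_le_iff₀ hβ, add_mul, one_mul, div_mul_cancel₀ _ hβ.ne']
      linarith
    calc _ ≤ _ := hmono
      _ = _ := heval
      _ ≤ 4 * T * Real.log (1 + (T₂ - T) / β) := by gcongr
  rw [← intervalIntegral.integral_add_adjacent_intervals (hcont.intervalIntegrable T c')
    (hcont.intervalIntegrable c' T₂)]
  linarith

/-- **Levinson's Lemma 3.4 with a general `C¹` amplitude.** Let `1 ≤ T ≤ T₂ ≤ 2T`, `c > 0`, and
let `g : ℝ → ℂ` have a continuous derivative `g'` on `[T, T₂]` with `‖g‖ ≤ G₀`, `‖g'‖ ≤ G₁` there.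
Then
`‖∫_T^{T₂} g(t) e^{i t log(t/(ec))} dt − [T ≤ c ≤ T₂] g(c) 𝔣 e^{−ic} c^{1/2}‖`
`  ≤ (G₀ + (T₂−T)G₁)(275 + 32·4T/(|c−T| + √(2T))) + 32 G₀ · 4T/(|T₂−c| + √(2T)) + 256 G₁ T log(1 + T)`
(partial integration against the primitive `∫_T^t e^{i s log(s/(ec))} ds`, which is
`[T ≤ c ≤ t] 𝔣 e^{−ic} c^{1/2} + O(1 + 4T/(|c−T|+√(2T)) + 4T/(|t−c|+√(2T)))` by
`norm_logPhaseIntegral_sub_indicator_main_le_sharp`, and `integral_levinson_endpoint_le`).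
For Levinson's amplitude `g(t) = (t/2π)^{½−a}`, `½ − a = O(1/log T)`, one has `T G₁ = O(G₀/log T)`
and the bound is `O(G₀)(1 + 4T/(|c−T|+√T) + 4T/(|T₂−c|+√T))`, which is his `E(r)`.
[cite: Levinson1974, Lemma 3.4] -/
theorem norm_integral_mul_logPhase_sub_le {T T₂ c G₀ G₁ : ℝ} {g g' : ℝ → ℂ} (hT : 1 ≤ T)
    (hTT₂ : T ≤ T₂) (hT₂ : T₂ ≤ 2 * T) (hc : 0 < c) (hg : ∀ t ∈ Icc T T₂, HasDerivAt g (g' t) t)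
    (hg' : ContinuousOn g' (Icc T T₂)) (hG₀ : ∀ t ∈ Icc T T₂, ‖g t‖ ≤ G₀)
    (hG₁ : ∀ t ∈ Icc T T₂, ‖g' t‖ ≤ G₁) :
    ‖(∫ t in T..T₂, g t * cexp (I * ((t * Real.log (t / (Real.exp 1 * c)) : ℝ) : ℂ)))
        - (if T ≤ c ∧ c ≤ T₂ then g c * (fresnelC * cexp (-I * c) * (Real.sqrt c : ℂ)) else 0)‖ ≤
      (G₀ + (T₂ - T) * G₁) * (275 + 32 * (4 * T / (|c - T| + Real.sqrt (2 * T))))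
        + 32 * G₀ * (4 * T / (|T₂ - c| + Real.sqrt (2 * T)))
        + 256 * G₁ * T * Real.log (1 + T) := by
  have hT0 : 0 < T := by linarith
  have hT₂0 : 0 < T₂ := by linarith
  have h2T : 0 < 2 * T := by linarith
  have hs : 0 < Real.sqrt (2 * T) := Real.sqrt_pos.2 h2T
  have hG₀0 : 0 ≤ G₀ := (norm_nonneg _).trans (hG₀ T ⟨le_rfl, hTT₂⟩)
  have hG₁0 : 0 ≤ G₁ := (norm_nonneg _).trans (hG₁ T ⟨le_rfl, hTT₂⟩)
  have huIcc : uIcc T T₂ = Icc T T₂ := uIcc_of_le hTT₂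
  -- the oscillatory factor and its primitive
  set osc : ℝ → ℂ := fun t => cexp (I * ((t * Real.log (t / (Real.exp 1 * c)) : ℝ) : ℂ)) with hosc
  have hosc_cont : Continuous osc := continuous_logPhaseExp hc
  have hosc_norm : ∀ t, ‖osc t‖ = 1 := fun t => by
    simp only [hosc]; exact Complex.norm_exp_I_mul_ofReal _
  set Ψ : ℝ → ℂ := fun t => ∫ s in T..t, osc s with hΨ
  have hΨd : ∀ t, HasDerivAt Ψ (osc t) t := fun t =>
    intervalIntegral.integral_hasDerivAt_right (hosc_cont.intervalIntegrable _ _)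
      (hosc_cont.stronglyMeasurableAtFilter _ _) hosc_cont.continuousAt
  have hΨT : Ψ T = 0 := by simp [hΨ]
  have hΨcont : Continuous Ψ := continuous_iff_continuousAt.2 fun t => (hΨd t).continuousAt
  -- the main term and the error of the primitive
  set M : ℂ := fresnelC * cexp (-I * c) * (Real.sqrt c : ℂ) with hM
  set χ : ℝ → ℂ := fun t => if T ≤ c ∧ c ≤ t then M else 0 with hχ
  set E₁ : ℝ := 4 * T / (|c - T| + Real.sqrt (2 * T)) with hE₁
  have hE₁0 : 0 ≤ E₁ := by positivity
  have herr : ∀ t ∈ Icc T T₂, ‖Ψ t - χ t‖ ≤ 275 + 32 * (E₁ + 4 * T / (|t - c| + Real.sqrt (2 * T))) := by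
    intro t ht
    have h := norm_logPhaseIntegral_sub_indicator_main_le_sharp hT0 ht.1 (ht.2.trans hT₂) hc
    simpa only [hΨ, hχ, hosc, hM, hE₁] using h
  -- integration by parts
  have hparts : ∫ t in T..T₂, g t * osc t = g T₂ * Ψ T₂ - ∫ t in T..T₂, g' t * Ψ t := by
    have h := intervalIntegral.integral_mul_deriv_eq_deriv_mul (a := T) (b := T₂) (u := g) (v := Ψ)
      (u' := g') (v' := osc) (fun x hx => hg x (huIcc ▸ hx)) (fun x _ => hΨd x)
      ((hg'.mono (by rw [huIcc])).intervalIntegrable) (hosc_cont.intervalIntegrable _ _)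
    rw [h, hΨT, mul_zero, sub_zero]
  -- the integral of `g' χ`
  have hχint : IntervalIntegrable (fun t => g' t * χ t) volume T T₂ ∧
      ∫ t in T..T₂, g' t * χ t = if T ≤ c ∧ c ≤ T₂ then M * (g T₂ - g c) else 0 := by
    by_cases hcase : T ≤ c ∧ c ≤ T₂
    · rw [if_pos hcase]
      have hfun : (fun t => g' t * χ t) = (Ici c).indicator fun t => g' t * M := by
        funext t
        simp only [hχ, Set.indicator, mem_Ici]
        by_cases hct : c ≤ t
        · rw [if_pos ⟨hcase.1, hct⟩, if_pos hct]
        · rw [if_neg (fun h => hct h.2), if_neg hct, mul_zero]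
      have hg'M : ContinuousOn (fun t => g' t * M) (Icc T T₂) := hg'.mul continuousOn_const
      have hIO : IntegrableOn (fun t => g' t * M) (Ioc T T₂) :=
        (hg'M.integrableOn_Icc).mono_set Ioc_subset_Icc_self
      refine ⟨?_, ?_⟩
      · rw [hfun, intervalIntegrable_iff_integrableOn_Ioc_of_le hTT₂]
        exact hIO.indicator measurableSet_Ici
      · rw [hfun, intervalIntegral.integral_of_le hTT₂, setIntegral_indicator measurableSet_Ici]
        -- `Ioc T T₂ ∩ Ici c` is `Ioc c T₂` up to the point `c`
        have hset : ∫ t in Ioc T T₂ ∩ Ici c, g' t * M = ∫ t in Ioc c T₂, g' t * M := by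
          rcases eq_or_lt_of_le hcase.1 with h | h
          · have hset' : Ioc T T₂ ∩ Ici c = Ioc c T₂ := by
              ext t
              simp only [mem_inter_iff, mem_Ioc, mem_Ici]
              constructor
              · rintro ⟨⟨h1, h2⟩, _⟩; exact ⟨by rw [← h]; exact h1, h2⟩
              · rintro ⟨h1, h2⟩; exact ⟨⟨by rw [h]; exact h1, h2⟩, h1.le⟩
            rw [hset']
          · have hset' : Ioc T T₂ ∩ Ici c = Icc c T₂ := by
              ext t
              simp only [mem_inter_iff, mem_Ioc, mem_Ici, mem_Icc]
              constructor
              · rintro ⟨⟨_, h2⟩, h3⟩; exact ⟨h3, h2⟩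
              · rintro ⟨h1, h2⟩; exact ⟨⟨lt_of_lt_of_le h h1, h2⟩, h1⟩
            rw [hset', integral_Icc_eq_integral_Ioc]
        rw [hset, ← intervalIntegral.integral_of_le hcase.2]
        have hIcc : Icc c T₂ ⊆ Icc T T₂ := Icc_subset_Icc hcase.1 le_rfl
        have hderiv : ∀ t ∈ uIcc c T₂, HasDerivAt (fun t => g t * M) (g' t * M) t := by
          intro t ht
          rw [uIcc_of_le hcase.2] at ht
          exact (hg t (hIcc ht)).mul_const M
        rw [intervalIntegral.integral_eq_sub_of_hasDerivAt hderiv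
          ((hg'M.mono hIcc).intervalIntegrable_of_Icc hcase.2)]
        ring
    · rw [if_neg hcase]
      have hzero : EqOn (fun t => g' t * χ t) (fun _ => 0) (uIcc T T₂) := by
        intro t ht
        rw [huIcc] at ht
        simp only [hχ]
        rw [if_neg (fun h => hcase ⟨h.1, h.2.trans ht.2⟩), mul_zero]
      refine ⟨?_, ?_⟩
      · refine (intervalIntegrable_const (c := (0 : ℂ))).congr ?_
        exact fun t ht => (hzero (uIoc_subset_uIcc ht)).symm
      · rw [intervalIntegral.integral_congr hzero, intervalIntegral.integral_zero]
  obtain ⟨hχi, hχeval⟩ := hχint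
  -- split `∫ g' Ψ = ∫ g' (Ψ − χ) + ∫ g' χ`
  have hg'Ψ : IntervalIntegrable (fun t => g' t * Ψ t) volume T T₂ :=
    ((hg'.mul hΨcont.continuousOn).mono (by rw [huIcc])).intervalIntegrable
  have hsplit : ∫ t in T..T₂, g' t * Ψ t =
      (∫ t in T..T₂, g' t * (Ψ t - χ t)) + ∫ t in T..T₂, g' t * χ t := by
    rw [← intervalIntegral.integral_add (hg'Ψ.sub hχi |>.congr fun t _ => by ring) hχi]
    congr 1
    funext t
    ring
  -- assemble: `LHS − main = g(T₂)(Ψ − χ)(T₂) − ∫ g'(Ψ − χ)`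
  have hkey : (∫ t in T..T₂, g t * osc t) -
      (if T ≤ c ∧ c ≤ T₂ then g c * M else 0) =
      g T₂ * (Ψ T₂ - χ T₂) - ∫ t in T..T₂, g' t * (Ψ t - χ t) := by
    rw [hparts, hsplit, hχeval]
    simp only [hχ]
    by_cases hcase : T ≤ c ∧ c ≤ T₂
    · rw [if_pos hcase, if_pos hcase, if_pos hcase]; ring
    · rw [if_neg hcase, if_neg hcase, if_neg hcase]; ring
  rw [hkey]
  -- the two error terms
  have hbound1 : ‖g T₂ * (Ψ T₂ - χ T₂)‖ ≤
      G₀ * (275 + 32 * (E₁ + 4 * T / (|T₂ - c| + Real.sqrt (2 * T)))) := by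
    rw [norm_mul]
    exact mul_le_mul (hG₀ T₂ ⟨hTT₂, le_rfl⟩) (herr T₂ ⟨hTT₂, le_rfl⟩) (norm_nonneg _) hG₀0
  have hbound2 : ‖∫ t in T..T₂, g' t * (Ψ t - χ t)‖ ≤
      G₁ * ((T₂ - T) * (275 + 32 * E₁)) + 32 * G₁ * (8 * T * Real.log (1 + (T₂ - T) / Real.sqrt (2 * T))) := by
    have hb : ∀ t ∈ Icc T T₂, ‖g' t * (Ψ t - χ t)‖ ≤
        G₁ * (275 + 32 * E₁) + 32 * G₁ * (4 * T / (|t - c| + Real.sqrt (2 * T))) := by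
      intro t ht
      rw [norm_mul]
      calc ‖g' t‖ * ‖Ψ t - χ t‖ ≤ G₁ * (275 + 32 * (E₁ + 4 * T / (|t - c| + Real.sqrt (2 * T)))) :=
            mul_le_mul (hG₁ t ht) (herr t ht) (norm_nonneg _) hG₁0
        _ = _ := by ring
    have hcontb : Continuous fun t : ℝ => G₁ * (275 + 32 * E₁) +
        32 * G₁ * (4 * T / (|t - c| + Real.sqrt (2 * T))) := by
      refine continuous_const.add (continuous_const.mul ?_)
      exact continuous_const.div (by fun_prop) fun t => by positivity
    calc ‖∫ t in T..T₂, g' t * (Ψ t - χ t)‖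
        ≤ ∫ t in T..T₂, (G₁ * (275 + 32 * E₁) + 32 * G₁ * (4 * T / (|t - c| + Real.sqrt (2 * T)))) :=
          intervalIntegral.norm_integral_le_of_norm_le hTT₂
            (Filter.Eventually.of_forall fun t ht => hb t (Ioc_subset_Icc_self ht))
            (hcontb.intervalIntegrable _ _)
      _ = G₁ * ((T₂ - T) * (275 + 32 * E₁)) +
          32 * G₁ * ∫ t in T..T₂, 4 * T / (|t - c| + Real.sqrt (2 * T)) := by
          rw [intervalIntegral.integral_add (intervalIntegrable_const)
            ((continuous_const.div (by fun_prop) fun t => by positivity).intervalIntegrable _ _ |>.const_mul _),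
            intervalIntegral.integral_const, intervalIntegral.integral_const_mul]
          simp only [smul_eq_mul]
          ring
      _ ≤ _ := by
          gcongr
          exact integral_levinson_endpoint_le hT0.le hTT₂ hs
  -- final arithmetic
  have hlog : Real.log (1 + (T₂ - T) / Real.sqrt (2 * T)) ≤ Real.log (1 + T) := by
    apply Real.log_le_log (by positivity)
    have hs1 : 1 ≤ Real.sqrt (2 * T) := by
      rw [Real.le_sqrt (by norm_num) h2T.le]; linarith
    have : (T₂ - T) / Real.sqrt (2 * T) ≤ T := by
      rw [div_le_iff₀ hs]; nlinarith
    linarith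
  have hlog0 : 0 ≤ Real.log (1 + T) := Real.log_nonneg (by linarith)
  calc _ ≤ ‖g T₂ * (Ψ T₂ - χ T₂)‖ + ‖∫ t in T..T₂, g' t * (Ψ t - χ t)‖ := norm_sub_le _ _
    _ ≤ G₀ * (275 + 32 * (E₁ + 4 * T / (|T₂ - c| + Real.sqrt (2 * T)))) +
        (G₁ * ((T₂ - T) * (275 + 32 * E₁)) +
          32 * G₁ * (8 * T * Real.log (1 + (T₂ - T) / Real.sqrt (2 * T)))) := add_le_add hbound1 hbound2
    _ ≤ G₀ * (275 + 32 * (E₁ + 4 * T / (|T₂ - c| + Real.sqrt (2 * T)))) +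
        (G₁ * ((T₂ - T) * (275 + 32 * E₁)) + 32 * G₁ * (8 * T * Real.log (1 + T))) := by
        gcongr
    _ = _ := by ring

/-- **Levinson's Lemma 3.4** (the amplitude `(t/2π)^{½−a}`, here `(t/2π)^κ` with `κ ≥ 0`): for
`1 ≤ T ≤ T₂ ≤ 2T` and `c > 0`,
`‖∫_T^{T₂} (t/2π)^κ e^{i t log(t/(ec))} dt − [T ≤ c ≤ T₂] (c/2π)^κ 𝔣 e^{−ic} c^{1/2}‖`
`  ≤ (T/π)^κ ((1+κ)(275 + 32·4T/(|c−T|+√(2T))) + 32·4T/(|T₂−c|+√(2T)) + 256 κ log(1+T))`.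
With `κ = ½ − a`, `(c/2π)^κ 𝔣 e^{−ic} c^{1/2} = (2π)^a c^{1−a} e^{−ic + πi/4}` is Levinson's main term
and, for `κ = O(1/log T)`, the right-hand side is his
`E(c) = O(1) + O(T/(|T−c| + T^{1/2})) + O(T₂/(|T₂−c| + T₂^{1/2}))` ((3.8)); the case `c ∉ [T, T₂]`
("for `r < A` or `r > B` the integral is `E(r)`") is included. [cite: Levinson1974, Lemma 3.4] -/
theorem norm_integral_rpow_mul_logPhase_sub_le {T T₂ c κ : ℝ} (hT : 1 ≤ T) (hTT₂ : T ≤ T₂)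
    (hT₂ : T₂ ≤ 2 * T) (hc : 0 < c) (hκ0 : 0 ≤ κ) :
    ‖(∫ t in T..T₂, (((t / (2 * π)) ^ κ : ℝ) : ℂ) *
          cexp (I * ((t * Real.log (t / (Real.exp 1 * c)) : ℝ) : ℂ)))
        - (if T ≤ c ∧ c ≤ T₂ then (((c / (2 * π)) ^ κ : ℝ) : ℂ) *
            (fresnelC * cexp (-I * c) * (Real.sqrt c : ℂ)) else 0)‖ ≤
      (T / π) ^ κ * ((1 + κ) * (275 + 32 * (4 * T / (|c - T| + Real.sqrt (2 * T))))
        + 32 * (4 * T / (|T₂ - c| + Real.sqrt (2 * T))) + 256 * κ * Real.log (1 + T)) := by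
  have hπ := Real.pi_pos
  have hT0 : 0 < T := by linarith
  have h2T : 0 < 2 * T := by linarith
  have hs : 0 < Real.sqrt (2 * T) := Real.sqrt_pos.2 h2T
  set G₀ : ℝ := (T / π) ^ κ with hG₀
  have hG₀0 : 0 < G₀ := Real.rpow_pos_of_pos (by positivity) _
  have hpos : ∀ t ∈ Icc T T₂, 0 < t / (2 * π) := fun t ht => by
    have : 0 < t := by linarith [ht.1]
    positivity
  -- the amplitude and its derivative
  have hgd : ∀ t ∈ Icc T T₂, HasDerivAt (fun t : ℝ => (((t / (2 * π)) ^ κ : ℝ) : ℂ))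
      (((κ * (t / (2 * π)) ^ (κ - 1) * (1 / (2 * π)) : ℝ) : ℂ)) t := by
    intro t ht
    have h1 : HasDerivAt (fun t : ℝ => t / (2 * π)) (1 / (2 * π)) t := by
      simpa using (hasDerivAt_id t).div_const (2 * π)
    have h2 := (Real.hasDerivAt_rpow_const (p := κ) (Or.inl (hpos t ht).ne')).comp t h1
    exact h2.ofReal_comp
  have hg0 : ∀ t ∈ Icc T T₂, (t / (2 * π)) ^ κ ≤ G₀ := by
    intro t ht
    have h1 : t / (2 * π) ≤ T / π := by
      rw [div_le_div_iff₀ (by positivity) hπ]; nlinarith [ht.2]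
    exact Real.rpow_le_rpow (hpos t ht).le h1 hκ0
  have hG₀b : ∀ t ∈ Icc T T₂, ‖(((t / (2 * π)) ^ κ : ℝ) : ℂ)‖ ≤ G₀ := by
    intro t ht
    rw [Complex.norm_real, Real.norm_of_nonneg (Real.rpow_nonneg (hpos t ht).le _)]
    exact hg0 t ht
  have hG₁b : ∀ t ∈ Icc T T₂, ‖((κ * (t / (2 * π)) ^ (κ - 1) * (1 / (2 * π)) : ℝ) : ℂ)‖ ≤ κ * G₀ / T := by
    intro t ht
    have ht0 : 0 < t := by linarith [ht.1]
    have e : κ * (t / (2 * π)) ^ (κ - 1) * (1 / (2 * π)) = κ * (t / (2 * π)) ^ κ / t := by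
      rw [Real.rpow_sub_one (hpos t ht).ne']
      field_simp
    have hnn : 0 ≤ κ * (t / (2 * π)) ^ (κ - 1) * (1 / (2 * π)) := by
      rw [e]; exact div_nonneg (mul_nonneg hκ0 (Real.rpow_nonneg (hpos t ht).le _)) ht0.le
    rw [Complex.norm_real, Real.norm_of_nonneg hnn, e, div_le_div_iff₀ ht0 hT0]
    calc κ * (t / (2 * π)) ^ κ * T ≤ κ * G₀ * T := by gcongr; exact hg0 t ht
      _ ≤ κ * G₀ * t := by gcongr; exact ht.1
  have hcont : ContinuousOn (fun t : ℝ => ((κ * (t / (2 * π)) ^ (κ - 1) * (1 / (2 * π)) : ℝ) : ℂ))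
      (Icc T T₂) := by
    refine Complex.continuous_ofReal.comp_continuousOn ?_
    refine ((continuousOn_const.mul ?_).mul continuousOn_const)
    exact (continuousOn_id.div_const _).rpow_const fun t ht => Or.inl (hpos t ht).ne'
  have key := norm_integral_mul_logPhase_sub_le hT hTT₂ hT₂ hc hgd hcont hG₀b hG₁b
  refine key.trans ?_
  -- arithmetic: `(T₂ − T) κ G₀/T ≤ κ G₀` and `(κ G₀/T) T = κ G₀`
  have hE₁0 : 0 ≤ 4 * T / (|c - T| + Real.sqrt (2 * T)) := by positivity
  have hE₂0 : 0 ≤ 4 * T / (|T₂ - c| + Real.sqrt (2 * T)) := by positivity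
  have hlog0 : 0 ≤ Real.log (1 + T) := Real.log_nonneg (by linarith)
  have h1 : (T₂ - T) * (κ * G₀ / T) ≤ κ * G₀ := by
    rw [mul_div_assoc', div_le_iff₀ hT0]
    have : 0 ≤ κ * G₀ := by positivity
    nlinarith
  have h2 : 256 * (κ * G₀ / T) * T * Real.log (1 + T) = G₀ * (256 * κ * Real.log (1 + T)) := by
    field_simp
  rw [h2]
  have h3 : (G₀ + (T₂ - T) * (κ * G₀ / T)) * (275 + 32 * (4 * T / (|c - T| + Real.sqrt (2 * T)))) ≤
      G₀ * ((1 + κ) * (275 + 32 * (4 * T / (|c - T| + Real.sqrt (2 * T))))) := by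
    have : G₀ + (T₂ - T) * (κ * G₀ / T) ≤ G₀ * (1 + κ) := by nlinarith
    calc _ ≤ G₀ * (1 + κ) * (275 + 32 * (4 * T / (|c - T| + Real.sqrt (2 * T)))) := by
          gcongr
      _ = _ := by ring
  nlinarith [h3, hG₀0.le, hE₂0]

end Literature.Analysis.Fourier
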